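import Literature.AlgebraicGeometry.HodgeTheory.SaitoGrFDeRhamCurveNetOfFacts
import Literature.AlgebraicGeometry.HodgeTheory.GysinHodgeClassLiftProofs
import Literature.AlgebraicGeometry.Resolution.ProjectiveResolutionProofs
import HarnessLib

/-!
# Polarizability of the Hodge structure on `Hᵏ(Y(ℂ); ℚ)` of a smooth projective variety
# (Hodge–Riemann; named fact), and two facts of the `hodge` family assembled from it

Family `hodge`, layer `Literature/AlgebraicGeometry/HodgeTheory`. Fact-decomposition record
(librarian, `fact-decompose`, 2026-08-16) for TWO named facts of the tree which the sibling proofs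
files have reduced to named facts plus ONE common un-named classical input:

* `curveNetSaitoData_nonempty` (`SaitoGrFDeRhamCurveNet.lean`: Saito's graded de Rham package of
  `IC(R¹π_*ℚ)` of a curve net on `ℙᵐ_ℂ`, `m ≥ 2`, anchored to `H^{m+1}(X̃(ℂ); ℂ)`, exists) —
  reduced in `SaitoGrFDeRhamCurveNetOfFacts` (`curveNetSaitoData_nonempty_of_namedFacts`) to the
  named facts `exists_isReal_hodgeModel`, `Deligne1974_ker_restrictCompl_eq_iSup_range_complexGysin`,
  `Resolution.Hironaka1964_projective` (since discharged: `Hironaka1964_projective_holds`),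
  `Literature.NumberTheory.Transcendental.exists_deRhamIsoFamily` (multiplicative de Rham theorem,
  for finite-dimensional complex model spaces) and the polarizability `hpol`;
* `Voisin2025_hodgeClass_lift_complexGysin` (`GysinHodgeClassLift.lean`: Hodge classes lift along
  sums of Gysin morphisms, Voisin 2025 Cor. 2.12 by the semisimplicity of polarizable Hodge
  structures) — reduced in `GysinHodgeClassLiftProofs`
  (`Voisin2025_hodgeClass_lift_complexGysin_of_exists_isReal_hodgeModel`) to `exists_isReal_hodgeModel`,
  `hodgePQ_independent_of_hodgeModel` (since discharged: `…_holds`), `exists_deRhamIsoFamily` and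
  the same `hpol`.

`hpol` is the Hodge–Riemann package on the tree's carriers: for `Y` smooth projective over `ℂ` and
a Hodge symmetric Hodge model `A` of `Y` (all models induce the same `H^{p,q}`,
`hodgePQ_independent_of_hodgeModel_holds`), the pure `ℚ`-Hodge structure
`A.hodgeStructure hY hA k` of weight `k` on `Hᵏ(Y(ℂ); ℚ)` (`HodgeStructureOfHodgeModel`) is
POLARIZABLE — C. Voisin, *Hodge Theory and Complex Algebraic Geometry I* (2002), Thm. 6.32
(Hodge–Riemann bilinear relations) with the Lefschetz decomposition (Thm. 6.25) for the class of an
ample line bundle, which is rational, so that the primitive decomposition and the form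
`Q(α, β) = Σ_r (-1)^r ∫ L^{n-k+2r} α_r ∧ β_r` are defined over `ℚ` (§7.1.2: "the Hodge structure
on `Hᵏ(X, ℚ)` of a projective manifold is polarised"). In this exact binder shape it is the
hypothesis of `GysinHodgeClassLiftProofs`, `SaitoGrFDeRhamCurveNetOfFacts` and
`HodgeConjectureQbarVoisinProofs`; the tree has no carrier-level Hodge–Riemann statement yet
(hard Lefschetz is the named fact of `HardLefschetzHodgeRiemann.lean`).

This file NAMES `hpol` as the fact `smoothProjective_hodgeStructure_isPolarizable` and records the
two assemblies `curveNetSaitoData_nonempty_holds_of` and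
`Voisin2025_hodgeClass_lift_complexGysin_holds_of` (one line each; the discharged inputs are fed by
their `_holds` theorems).

## References

* [VoisinHodgeI2002] C. Voisin, Hodge Theory and Complex Algebraic Geometry I, CUP 2002: Thm. 6.25
  (Lefschetz decomposition), Thm. 6.32 (Hodge–Riemann bilinear relations), §7.1.1–7.1.2
  (integral/rational structure; polarised Hodge structures of projective manifolds), Lemma 7.26.
* [Voisin2025] C. Voisin, Hodge and generalized Hodge conjectures, coniveau and algebraic cycles,
  J. Open Math. Probl. 1 (2025): Prop. 2.11, Cor. 2.12.
* [Saito1990] M. Saito, Mixed Hodge modules, Publ. RIMS 26 (1990), Thm. 0.1–0.2.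
-/

noncomputable section

open scoped Manifold ContDiff
open CategoryTheory AlgebraicGeometry
open Literature.AlgebraicTopology.SingularHomology
open Literature.NumberTheory.Transcendental (exists_deRhamIsoFamily)

namespace Literature.AlgebraicGeometry.HodgeTheory

section HodgeTheory

/-- NAMED FACT — **the Hodge structure on the rational cohomology of a smooth projective complex
variety is polarizable** (Hodge–Riemann bilinear relations with the Lefschetz decomposition for a
rational Kähler class: Voisin I, Thm. 6.32 and Thm. 6.25, §7.1.2). On the tree's carriers: for `Y`
smooth projective of dimension `m` over `ℂ`, every Hodge symmetric Hodge model `A` of `Y` and every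
`k`, the weight-`k` Hodge structure `A.hodgeStructure hY hA k` on `Hᵏ(Y(ℂ); ℚ)`
(`HodgeStructureOfHodgeModel`; independent of `A` by `hodgePQ_independent_of_hodgeModel_holds`)
admits a polarization (`Motives.HodgeStructure.IsPolarizable`). The hypothesis `hpol` of
`curveNetSaitoData_nonempty_of_namedFacts` and `Voisin2025_hodgeClass_lift_complexGysin_of_exists_isReal_hodgeModel`
verbatim; users take `(h : smoothProjective_hodgeStructure_isPolarizable)`.
[cite: VoisinHodgeI2002, Thm. 6.32 with Thm. 6.25 and §7.1.2] -/
def smoothProjective_hodgeStructure_isPolarizable : Prop :=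
  ∀ ⦃m : ℕ⦄ ⦃Y : Motives.SchemeOver ℂ⦄ (hY : Motives.IsSmoothProjective m Y) (A : HodgeModel m Y)
    (hA : A.IsHodgeSymmetric) (k : ℕ), (A.hodgeStructure hY hA k).IsPolarizable

/-- **Assembly (fact-decompose): `curveNetSaitoData_nonempty` from the named facts of the tree** —
real Hodge models (`exists_isReal_hodgeModel`), Deligne's description of the kernel of restriction
by Gysin images (`Deligne1974_ker_restrictCompl_eq_iSup_range_complexGysin`), de Rham's theorem in
multiplicative form (`exists_deRhamIsoFamily`, all finite-dimensional complex model spaces) and the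
polarizability `smoothProjective_hodgeStructure_isPolarizable` — by
`curveNetSaitoData_nonempty_of_namedFacts`, Hironaka's resolution being the theorem
`Resolution.Hironaka1964_projective_holds`. [cite: Saito1990, Thm. 0.1–0.2, §2.g and §4.5]
[cite: VoisinHodgeI2002, Thm. 6.32 and §7.3.2] -/
theorem curveNetSaitoData_nonempty_holds_of (hR : exists_isReal_hodgeModel)
    (hD : Deligne1974_ker_restrictCompl_eq_iSup_range_complexGysin)
    (hdR : ∀ (E : Type) [NormedAddCommGroup E] [NormedSpace ℂ E] [FiniteDimensional ℂ E],
      exists_deRhamIsoFamily 𝓘(ℝ, E))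
    (hpol : smoothProjective_hodgeStructure_isPolarizable) :
    curveNetSaitoData_nonempty :=
  curveNetSaitoData_nonempty_of_namedFacts hR hD
    Literature.AlgebraicGeometry.Resolution.Hironaka1964_projective_holds hdR hpol

/-- **Assembly (fact-decompose): `Voisin2025_hodgeClass_lift_complexGysin` from the named facts of
the tree** — real Hodge models (`exists_isReal_hodgeModel`), de Rham's theorem in multiplicative
form (`exists_deRhamIsoFamily`) and the polarizability
`smoothProjective_hodgeStructure_isPolarizable` — by
`Voisin2025_hodgeClass_lift_complexGysin_of_exists_isReal_hodgeModel`, the independence of `H^{p,q}`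
of the model being the theorem `hodgePQ_independent_of_hodgeModel_holds`.
[cite: Voisin2025, Cor. 2.12, Prop. 2.11 and proof of Prop. 3.8] [cite: VoisinHodgeI2002, Lemma 7.26 and §7.3.2] -/
theorem Voisin2025_hodgeClass_lift_complexGysin_holds_of (hR : exists_isReal_hodgeModel)
    (hdR : ∀ (E : Type) [NormedAddCommGroup E] [NormedSpace ℂ E] [FiniteDimensional ℂ E],
      exists_deRhamIsoFamily 𝓘(ℝ, E))
    (hpol : smoothProjective_hodgeStructure_isPolarizable) :
    Voisin2025_hodgeClass_lift_complexGysin :=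
  Voisin2025_hodgeClass_lift_complexGysin_of_exists_isReal_hodgeModel hR
    hodgePQ_independent_of_hodgeModel_holds hdR hpol

end HodgeTheory

end Literature.AlgebraicGeometry.HodgeTheory

end
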